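import Summits.RiemannHypothesis.RiemannHypothesis.Theorems.SoloInformedGroundStateDecay2

/-!
# Handoff (rh-explicit, prove-1): the explicit endgame of the Weil ground-energy upper bound

Solo's part XVI (`weilGroundEnergy_decayRadius_le_exp`, `weilGroundEnergy_exp_exp_decay`) runs the
chain «pointwise bound at the zeros ⇒ zero-sum bound ⇒ `Re Q(k)` bound; Mellin value at `2` ⇒ norm
from below; divide» for ONE specific family of test vectors and with an ineffective rate.  This file
isolates that chain as two generic, fully explicit inequalities, so that any explicit window test
(e.g. the Kaiser–Bessel-seeded one of the cell's paper Theorem E♭, handoff/prove-1/ATTEMPT-11) turns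
into an explicit bound for `weilGroundEnergy` by instantiation:

* `weilGroundEnergy_le_of_zero_decay`: if `k` is a Weil test function supported in `[-a, a]` with
  `‖k̂(ρ)‖² ≤ A/(1+γ²)²` at every non-trivial zero and `c ≤ ‖k̂(2)‖`, `c > 0`, then
  `ε(a) ≤ A · W · (2a e^{3a}) / c²`, `W = Σ'_ρ w(ρ)` the tree's zero weight sum;
* `weilGroundEnergy_le_of_window_mollifier`: the same for `k = g ⋆ m` from `‖ĝ(ρ)‖ ≤ G₀` at the zeros
  (window), the strip decay constant of `m` (mollifier), and lower bounds for `‖ĝ(2)‖`, `‖m̂(2)‖`.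

No hypothesis on the zeros is used (the zero side is `re_weilQuadratic_le_of_zeroSum_le`, the
explicit formula with the pairing `ρ ↔ 1-ρ̄`).  Nothing here bears on RH: these are upper bounds on an
infimum.
-/

set_option linter.dupNamespace false  -- the mandated namespace repeats `RiemannHypothesis`

noncomputable section

open Filter Set Topology MeasureTheory
open Literature.NumberTheory.LFunctions Literature.NumberTheory.LFunctions.WeilContinuous

namespace Summit.RiemannHypothesis.RiemannHypothesis.Theorems.HandoffRouteE

open Summit.RiemannHypothesis.RiemannHypothesis.Theorems

/-- **Explicit endgame, pointwise form** [Bombieri 2000 §4 (the ground energy); the chain is Solo part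
XVI made generic]: a Weil test function `k` supported in `[-a, a]` (`a > 0`) with
`‖k̂(ρ)‖² ≤ A/(1 + (Im ρ)²)²` at every non-trivial zero of `ζ` and `0 < c ≤ ‖k̂(2)‖` gives
`ε(a) ≤ A · (Σ'_ρ w(ρ)) · (2a·e^{3a}) / c²`. [cite: Bombieri2000Weil, §4] -/
theorem weilGroundEnergy_le_of_zero_decay {k : ℝ → ℂ} (hk : IsWeilTest k) {a : ℝ} (ha : 0 < a)
    (hsupp : tsupport k ⊆ Icc (-a) a) {A c : ℝ} (hA : 0 ≤ A) (hc : 0 < c)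
    (hzero : ∀ ρ ∈ ZetaZeros.riemannZetaNontrivialZeros,
      ‖weilMellin k ρ‖ ^ 2 ≤ A / (1 + ρ.im ^ 2) ^ 2)
    (h2 : c ≤ ‖weilMellin k 2‖) :
    weilGroundEnergy a ≤
      A * (∑' ρ : ZetaZeros.riemannZetaNontrivialZeros, weilZeroWeight (ρ : ℂ)) *
        (2 * a * Real.exp (3 * a)) / c ^ 2 := by
  set W : ℝ := ∑' ρ : ZetaZeros.riemannZetaNontrivialZeros, weilZeroWeight (ρ : ℂ) with hW
  have hW0 : 0 ≤ W := tsum_weilZeroWeight_nonneg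
  -- zero side
  have hsum := zeroSum_le_of_norm_sq_le (g := k) (A := A) hA hzero
  have hQ : (weilQuadratic k).re ≤ A * W := re_weilQuadratic_le_of_zeroSum_le hk hsum
  -- norm side
  set N2 : ℝ := ∫ t : ℝ, ‖k t‖ ^ 2 with hN2
  have hlow : c ^ 2 * (Real.exp (-(3 * a)) / (2 * a)) ≤ N2 := by
    calc c ^ 2 * (Real.exp (-(3 * a)) / (2 * a))
        ≤ ‖weilMellin k 2‖ ^ 2 * (Real.exp (-(3 * a)) / (2 * a)) :=
          mul_le_mul_of_nonneg_right (pow_le_pow_left₀ hc.le h2 2) (by positivity)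
      _ ≤ N2 := integral_norm_sq_ge_of_support hk ha hsupp
  have hlowpos : 0 < c ^ 2 * (Real.exp (-(3 * a)) / (2 * a)) := by positivity
  have hN2pos : 0 < N2 := hlowpos.trans_le hlow
  have hR := weilGroundEnergy_le_div hk hsupp hN2pos
  have hnum : 0 ≤ A * W := by positivity
  calc weilGroundEnergy a ≤ (weilQuadratic k).re / N2 := hR
    _ ≤ A * W / N2 := div_le_div_of_nonneg_right hQ hN2pos.le
    _ ≤ A * W / (c ^ 2 * (Real.exp (-(3 * a)) / (2 * a))) :=
        div_le_div_of_nonneg_left hnum hlowpos hlow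
    _ = A * W * (2 * a * Real.exp (3 * a)) / c ^ 2 := by
        rw [Real.exp_neg]
        field_simp

/-- **Explicit endgame, window ⋆ mollifier form** [Bombieri 2000 §4; Solo parts XV–XVI made generic]:
for Weil test functions `g` (window) and `m` (mollifier) with `k = g ⋆ m` supported in `[-a, a]`,
`‖ĝ(ρ)‖ ≤ G₀` at every non-trivial zero, `0 < c_g ≤ ‖ĝ(2)‖` and `0 < c_m ≤ ‖m̂(2)‖`:
`ε(a) ≤ (G₀ · D_m)² · (Σ'_ρ w(ρ)) · (2a·e^{3a}) / (c_g c_m)²`, where `D_m = weilDecayConst m` is the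
strip-decay constant (`‖m̂(s)‖ ≤ D_m/(1 + (Im s)²)` for `0 ≤ Re s ≤ 1`). [cite: Bombieri2000Weil, §4] -/
theorem weilGroundEnergy_le_of_window_mollifier {g m : ℝ → ℂ} (hg : IsWeilTest g)
    (hm : IsWeilTest m) {a : ℝ} (ha : 0 < a) (hsupp : tsupport (weilConv g m) ⊆ Icc (-a) a)
    {G₀ cg cm : ℝ} (hG₀ : 0 ≤ G₀) (hcg : 0 < cg) (hcm : 0 < cm)
    (hzero : ∀ ρ ∈ ZetaZeros.riemannZetaNontrivialZeros, ‖weilMellin g ρ‖ ≤ G₀)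
    (hg2 : cg ≤ ‖weilMellin g 2‖) (hm2 : cm ≤ ‖weilMellin m 2‖) :
    weilGroundEnergy a ≤
      (G₀ * weilDecayConst m) ^ 2 *
        (∑' ρ : ZetaZeros.riemannZetaNontrivialZeros, weilZeroWeight (ρ : ℂ)) *
          (2 * a * Real.exp (3 * a)) / (cg * cm) ^ 2 := by
  set D : ℝ := weilDecayConst m with hD
  have hD0 : 0 ≤ D := weilDecayConst_nonneg _
  have hk : IsWeilTest (weilConv g m) := hg.weilConv hm
  have hmul : ∀ s : ℂ, weilMellin (weilConv g m) s = weilMellin g s * weilMellin m s :=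
    fun s => weilMellin_weilConv_holds hg.1.continuous hg.2 hm.1.continuous hm.2 s
  have hzero' : ∀ ρ ∈ ZetaZeros.riemannZetaNontrivialZeros,
      ‖weilMellin (weilConv g m) ρ‖ ^ 2 ≤ (G₀ * D) ^ 2 / (1 + ρ.im ^ 2) ^ 2 := by
    intro ρ hρ
    obtain ⟨-, hre, hre1⟩ := mem_riemannZetaNontrivialZeros_iff_holds.1 hρ
    have hpos : 0 < 1 + ρ.im ^ 2 := by positivity
    have h1 : ‖weilMellin g ρ‖ ≤ G₀ := hzero ρ hρ
    have h2 : ‖weilMellin m ρ‖ ≤ D / (1 + ρ.im ^ 2) := norm_weilMellin_le hm hre.le hre1.le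
    have h3 : ‖weilMellin (weilConv g m) ρ‖ ≤ G₀ * D / (1 + ρ.im ^ 2) := by
      rw [hmul, norm_mul, mul_div_assoc]
      exact mul_le_mul h1 h2 (norm_nonneg _) hG₀
    calc ‖weilMellin (weilConv g m) ρ‖ ^ 2 ≤ (G₀ * D / (1 + ρ.im ^ 2)) ^ 2 :=
        pow_le_pow_left₀ (norm_nonneg _) h3 2
      _ = (G₀ * D) ^ 2 / (1 + ρ.im ^ 2) ^ 2 := by rw [div_pow]
  have h2' : cg * cm ≤ ‖weilMellin (weilConv g m) 2‖ := by
    rw [hmul, norm_mul]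
    exact mul_le_mul hg2 hm2 hcm.le (norm_nonneg _)
  exact weilGroundEnergy_le_of_zero_decay hk ha hsupp (by positivity) (by positivity) hzero' h2'

end Summit.RiemannHypothesis.RiemannHypothesis.Theorems.HandoffRouteE
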